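import Literature.Barriers.CriticalPhenomena.LongRangeTrivialityOnZ3Moments
import Literature.Barriers.CriticalPhenomena.LongRangeTrivialityOnZ3TwoPoint
import Literature.Probability.LatticeModels.AizenmanWickBoundLocal

/-!
# Panis's Theorem 1.2 from the deviation from Wick's law AS PRINTED (Aizenman's Proposition 12.1 /
# Panis's Proposition 4.6, pairing form); the misstated moment display and its correction

Sibling of `Literature/Barriers/CriticalPhenomena/LongRangeTrivialityOnZ3Moments.lean` (barrier
catalogue D-0021, sub-problem `Ising3DConformalLimit`). That file vendored the first display of the
proof of Panis's Theorem 5.5 (arXiv:2309.05797, p. 21),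

`|⟨T_{f,L,β}^{2n}⟩_β - (2n)!/(2ⁿn!)⟨T_{f,L,β}²⟩_βⁿ| ≤ (3/2)(2n)⁴ ⟨T_{|f|,L,β}^{2n-4}⟩_β ‖f‖_∞⁴ S(β,L,f)`   (5.1)

as the named fact `panis_evenMoment_deviation_le`, quantified (as printed) over all `n ≥ 2`, `L ≥ 1`
and all test functions. **That statement is false**: for `L = 1` and a bump `f` seen by the single
lattice site `0`, `T = σ₀/√Σ₁`, the left side is `((2n-1)!! - 1)Σ₁⁻ⁿ` and the right side is
`O((2n)⁴)Σ₁⁻ⁿ`; below, `not_panis_evenMoment_deviation_le_of_criticalBeta_pos` PROVES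
`panis_criticalBeta_pos → ¬ panis_evenMoment_deviation_le` (`d = 2`, `α = 1/2`, `n = 12`). The source
of the error is upstream of Panis: the pointwise inequality behind (5.1) is PRINTED — Aizenman 1982,
Prop. 12.1, eq. (12.3), restated verbatim by Aizenman (CDM 2020 = arXiv:2112.04248, Prop. 7.2: "In
ferromagnetic Ising models, for any `n`") and by Panis (Prop. 4.6, "Deviation from Wick's law"), and
vendored for unit couplings on finite graphs in the tree's `AizenmanWickBound` — with the PAIRING
SUM of the remaining points,

`|⟨σ_{x₁}⋯σ_{x_{2n}}⟩ - ∑_π ∏ⱼ⟨σ_{x_{π(2j-1)}}σ_{x_{π(2j)}}⟩|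
   ≤ (3/2) ∑_{i<j<k<l} |U₄(x_i,x_j,x_k,x_l)| ∑_{π pairing of the other 2n-4 indices} ∏ⱼ ⟨σσ⟩`,   (P4.6)

whereas Aizenman–Duminil-Copin 2021, §6.3 print it with `S_{2n-4}(rest)` in place of the pairing sum —
a strictly stronger inequality that fails at coincident points (`n = 5`, all `x_i` equal:
`944 ≤ 630`) — and (5.1) is the smearing of that stronger form; smearing (P4.6) instead gives (5.1)
with `⟨T_{|f|,L,β}^{2n-4}⟩_β` replaced by the Gaussian moment `(2n-4)!/(2^{n-2}(n-2)!) ⟨T_{|f|,L,β}²⟩_β^{n-2}`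
(Aizenman CDM 2020, (7.6)–(7.9)), which is all the summation over `n` needs.

## What is here

* NAMED FACT `aizenman_pairInteraction_wickDeviation_le_finite` — (P4.6) for the finite-volume free-boundary Gibbs
  state `⟨·⟩_{Λ,J,0,β}` of ANY ferromagnetic pair interaction `J ≥ 0` on `ℤ^d`, `β ≥ 0`, points in `Λ`
  (the form the switching lemma proves: Panis §4 works in finite `Λ` with currents on `𝒫₂(Λ)` and
  weights `∏(βJ_{x,y})^{n_{x,y}}/n_{x,y}!`; Aizenman 1982 proves Prop. 12.1 "for finite systems of
  Ising spins, with a general two point ferromagnetic interaction"), in the shape of the tree's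
  unit-coupling fact `aizenman_wickDeviation_le_finite` (`wickRemainder`). Notation
  `LongRangeIsing.corrIn/pairIn/ursellFourIn` (finite volume), `corr` (infinite volume).
* PROVED `LongRangeIsing.wickDeviation_le_state`: (P4.6) for the infinite-volume state
  `⟨·⟩_{J,0,β}` (`J ≥ 0`, `β ≥ 0`; limit along boxes, `tendsto_expectIn_box`).
* PROVED: the infinite-volume state seen through a finite window `B` as a probability measure on
  `SpinConfig (Site d)` (`windowState`, the push-forward of `windowMeasure` of the Moments file under
  `glue`), with `∫ F d(windowState) = ⟨F⟩_{J,0,β}` for `B`-local `F`, whence its correlation functions,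
  `Σ_L`, `T_{f,L,β}`, `U₄` and `S` are the barrier's (`nPoint_windowState`, …, `ursellFourSum_windowState`).
* NAMED FACT (corrected statement of the misstated one, same cite) `panis_evenMoment_deviation_le_wick`:
  (5.1) with the Gaussian moment `(2n-4)!/(2^{n-2}(n-2)!)⟨T_{|f|,L,β}²⟩^{n-2}`; PROVED from
  `aizenman_pairInteraction_wickDeviation_le_finite` (`…_of_finite`, through
  `abs_integral_normalizedField_pow_sub_le_of_wickDeviationBoundOn` of `AizenmanWickBoundLocal`, the
  local form of the tree's smearing theorem — the window state satisfies the inequality only at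
  points of the window).
* PROVED `panis_mgfDeviation_le_ursellFourBoxSum_of_wick` (summation, `C₁ = 24`, via the tree's
  `abs_mgf_sub_exp_le_of_wickMoment_bounds` and flip symmetry), `panis_thm12_of_wick`,
  `LongRangeTrivialityOnZ3.of_wick`: the barrier from (P4.6) in finite volume and
  `panis_ursellFourBoxSum_le` — Newman's Gaussian domination is no longer needed.
* PROVED `not_panis_evenMoment_deviation_le_of_criticalBeta_pos`.

## References

* R. Panis, arXiv:2309.05797 = Ann. Probab. 54 (2026): §4 (p. 19), Prop. 4.6 (p. 20), proof of
  Thm. 5.5 (p. 21) [Panis2023Triviality] (held; read).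
* M. Aizenman, arXiv:2112.04248 (CDM 2020), Prop. 7.2 and (7.6)–(7.10) [AizenmanCDM2020] (read,
  pp. 23–25).
* M. Aizenman, Comm. Math. Phys. 86 (1982) 1–48, Prop. 12.1, eq. (12.3) [AizenmanCMP1982] (not held
  here; cited through the two restatements above and the tree's `AizenmanWickBound`).
* M. Aizenman, H. Duminil-Copin, arXiv:1912.07973, §6.3 (p. 26) [AizenmanDuminilCopinAnnals2021].
-/

noncomputable section

namespace Literature.Barriers.CriticalPhenomena

open Literature.Probability.LatticeModels Literature.Probability.Percolation Finset
open _root_.Filter _root_.Topology _root_.MeasureTheory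
open scoped symmDiff ENNReal Nat

namespace LongRangeIsing

variable {d : ℕ}

/-! ### Correlation functions of indexed families of sites (repetitions allowed) -/

section Correlations

variable (J : Site d → Site d → ℝ) (Λ : Finset (Site d)) (β : ℝ)

/-- The finite-volume correlation `⟨σ_{x₁} ⋯ σ_{x_m}⟩_{Λ,J,0,β}` of an indexed family of sites.
[cite: Panis2023Triviality, §4 (⟨σ_A⟩_{Λ,β}) and Prop. 4.6] -/
def corrIn {m : ℕ} (x : Fin m → Site d) : ℝ :=
  expectIn J Λ β 0 fun σ => ∏ i, spinAt (x i) σ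

/-- The finite-volume two-point function `⟨σ_a σ_b⟩_{Λ,J,0,β}`. [cite: Panis2023Triviality, §4 (⟨σ_0σ_x⟩_{Λ,β})] -/
def pairIn (a b : Site d) : ℝ :=
  expectIn J Λ β 0 fun σ => spinAt a σ * spinAt b σ

/-- The finite-volume four-point Ursell function
`U₄^{Λ,β}(u₀,u₁,u₂,u₃) = ⟨σ_{u₀}σ_{u₁}σ_{u₂}σ_{u₃}⟩_Λ - ⟨σ_{u₀}σ_{u₁}⟩_Λ⟨σ_{u₂}σ_{u₃}⟩_Λ -
⟨σ_{u₀}σ_{u₂}⟩_Λ⟨σ_{u₁}σ_{u₃}⟩_Λ - ⟨σ_{u₀}σ_{u₃}⟩_Λ⟨σ_{u₁}σ_{u₂}⟩_Λ`. [cite: Panis2023Triviality, §1.2.1 (display defining U₄^β), finite volume] -/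
def ursellFourIn (u : Fin 4 → Site d) : ℝ :=
  corrIn J Λ β u - pairIn J Λ β (u 0) (u 1) * pairIn J Λ β (u 2) (u 3) -
    pairIn J Λ β (u 0) (u 2) * pairIn J Λ β (u 1) (u 3) - pairIn J Λ β (u 0) (u 3) * pairIn J Λ β (u 1) (u 2)

/-- The infinite-volume correlation `⟨σ_{x₁} ⋯ σ_{x_m}⟩_{J,0,β}` of an indexed family of sites.
[cite: Panis2023Triviality, Prop. 4.6 (⟨σ_{x₁}…σ_{x_{2n}}⟩_β)] -/
def corr {m : ℕ} (x : Fin m → Site d) : ℝ :=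
  state J β 0 fun σ => ∏ i, spinAt (x i) σ

/-- `⟨σ_{u₀}σ_{u₁}σ_{u₂}σ_{u₃}⟩` as a `4`-point correlation. [folklore] -/
theorem corr_eq_fourCorrelation (u : Fin 4 → Site d) :
    corr J β u = fourCorrelation J β (u 0) (u 1) (u 2) (u 3) := by
  simp only [corr, fourCorrelation, Fin.prod_univ_four]

/-- `pairIn` is the finite-volume expectation of `σ_{{a}∆{b}}`. [folklore] -/
theorem pairIn_eq (a b : Site d) : pairIn J Λ β a b = expectIn J Λ β 0 (spinProduct ({a} ∆ {b})) := by
  rw [pairIn]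
  congr 1
  funext σ
  exact spinAt_mul_spinAt_eq_spinProduct a b σ

end Correlations

/-! ### Passage to the infinite-volume state along boxes -/

section Limit

variable (J : Site d → Site d → ℝ) (β : ℝ)

/-- `⟨σ_{x₁}⋯σ_{x_m}⟩_{Λ_L,J,0,β} → ⟨σ_{x₁}⋯σ_{x_m}⟩_{J,0,β}` (`β ≥ 0`, `J ≥ 0`; a spin monomial is a spin
product). [cite: Panis2023Triviality, §1.2.1 (infinite volume Gibbs measure by weak limits)] -/
theorem tendsto_corrIn_box (hβ : 0 ≤ β) (hJ : ∀ x y, 0 ≤ J x y) {m : ℕ} (x : Fin m → Site d) :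
    Tendsto (fun L : ℕ => corrIn J (box d L) β x) atTop (𝓝 (corr J β x)) := by
  classical
  obtain ⟨A, -, hA⟩ := exists_prod_spinAt_eq_spinProduct_subset x
  have h : (fun σ : SpinConfig (Site d) => ∏ i, spinAt (x i) σ) = spinProduct A := funext hA
  simp only [corrIn, corr, h]
  exact tendsto_expectIn_box J β hβ hJ A

/-- `|⟨σ_{x₁}⋯σ_{x_m}⟩_{J,0,β}| ≤ 1` (`β ≥ 0`, `J ≥ 0`). [folklore] -/
theorem abs_corr_le_one (hβ : 0 ≤ β) (hJ : ∀ x y, 0 ≤ J x y) {m : ℕ} (x : Fin m → Site d) :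
    |corr J β x| ≤ 1 := by
  have h := tendsto_corrIn_box J β hβ hJ x
  have hb : ∀ L : ℕ, |corrIn J (box d L) β x| ≤ 1 := fun L =>
    abs_expectIn_le_one J _ β 0 fun σ => by
      rw [Finset.abs_prod]
      exact Finset.prod_le_one (fun i _ => abs_nonneg _) fun i _ => (abs_spinAt (x i) σ).le
  refine abs_le.2 ⟨ge_of_tendsto' h fun L => (abs_le.1 (hb L)).1, le_of_tendsto' h fun L => (abs_le.1 (hb L)).2⟩

/-- `⟨σ_aσ_b⟩_{Λ_L} → ⟨σ_aσ_b⟩_{J,0,β}`. [cite: Panis2023Triviality, §1.2.1 (infinite volume Gibbs measure by weak limits)] -/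
theorem tendsto_pairIn_box (hβ : 0 ≤ β) (hJ : ∀ x y, 0 ≤ J x y) (a b : Site d) :
    Tendsto (fun L : ℕ => pairIn J (box d L) β a b) atTop (𝓝 (pairCorrelation J β a b)) := by
  simp_rw [pairIn_eq, pairCorrelation_eq]
  exact tendsto_expectIn_box J β hβ hJ _

/-- `U₄^{Λ_L,β}(u) → U₄^β(u)`. [cite: Panis2023Triviality, §1.2.1 (infinite volume Gibbs measure by weak limits)] -/
theorem tendsto_ursellFourIn_box (hβ : 0 ≤ β) (hJ : ∀ x y, 0 ≤ J x y) (u : Fin 4 → Site d) :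
    Tendsto (fun L : ℕ => ursellFourIn J (box d L) β u) atTop
      (𝓝 (ursellFour J β (u 0) (u 1) (u 2) (u 3))) := by
  rw [ursellFour, ← corr_eq_fourCorrelation]
  have hN := tendsto_corrIn_box J β hβ hJ u
  have hT := fun a b => tendsto_pairIn_box J β hβ hJ a b
  exact ((hN.sub ((hT _ _).mul (hT _ _))).sub ((hT _ _).mul (hT _ _))).sub ((hT _ _).mul (hT _ _))

/-- `𝒢_n[S₂](x)` only depends on the values `S₂(x_i, x_j)`. [folklore] -/
theorem pairingSum_congr_apply {α : Type*} {S S' : α → α → ℝ} {m : ℕ} {y : Fin (2 * m) → α}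
    (h : ∀ i j, S (y i) (y j) = S' (y i) (y j)) : pairingSum S m y = pairingSum S' m y := by
  unfold pairingSum
  congr 1
  exact Finset.sum_congr rfl fun τ _ => Finset.prod_congr rfl fun j _ => h _ _

end Limit

end LongRangeIsing

open LongRangeIsing

/-! ### Aizenman's Theorem 12.1 = Panis's Proposition 4.6, as printed (pairing form), finite volume -/

/-- NAMED FACT — **the deviation from Wick's law (Aizenman 1982, Prop. 12.1; Panis 2023,
Prop. 4.6), pairing form, in finite volume, general pair interaction.** Panis, Prop. 4.6 "Deviation from Wick's law": "Let
`d ≥ 2` and `n ≥ 2`. For all `x₁,…,x_{2n} ∈ ℤ^d`,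
`|⟨σ_{x₁}…σ_{x_{2n}}⟩_β - ∑_{π pairing of {1,…,2n}} ∏_{j=1}^n ⟨σ_{x_{π(2j-1)}}σ_{x_{π(2j)}}⟩_β|
 ≤ (3/2) ∑_{1≤i<j<k<ℓ≤2n} |U₄^β(x_i,x_j,x_k,x_ℓ)| ∑_{π pairing of {1,…,2n}∖{i,j,k,ℓ}} ∏_{j=1}^{n-2} ⟨σ_{x_{π(2j-1)}}σ_{x_{π(2j)}}⟩_β`"
(the model of §4: an interaction `J` on `ℤ^d` satisfying (A1)–(A5), currents on the pairs of a
finite `Λ` with weights `∏(βJ_{x,y})^{n_{x,y}}/n_{x,y}!`, infinite volume by weak limits [ADCS]);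
Aizenman CDM 2020, Prop. 7.2 ("[1] (Theorem 12.1)"): "In ferromagnetic Ising models, for any `n ∈ ℕ`,
`0 ≤ 𝒢_{2n}[S₂](x₁,…,x_{2n}) - S_{2n}(x₁,…,x_{2n}) ≤ -(3/2)∑_{j<k<l<m} U₄(x_j,x_k,x_l,x_m)·𝒢_{2n-4}[S₂](…,x̸_j,…,x̸_k,…,x̸_l,…,x̸_m,…)`",
"derived in [1] through the random currents' switching lemma" (a finite-graph identity, Panis
Lemma 4.4); Aizenman 1982, Prop. 12.1, eq. (12.3): `|S_{2n} - G_{2n}| ≤ (3/2) R_{2n}`, proved "for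
finite systems of Ising spins, with a general two point ferromagnetic interaction" (as vendored for
unit couplings in the tree's `aizenman_wickDeviation_le_finite`). Vendored in the FINITE-VOLUME form
the switching lemma establishes: the free-boundary
zero-field Gibbs state `⟨·⟩_{Λ,J,0,β}` (`LongRangeIsing.expectIn`) of any ferromagnetic pair
interaction `J ≥ 0` on `ℤ^d`, `β ≥ 0`, finite `Λ`, points `x_i ∈ Λ`, with Panis's absolute values;
`𝒢` is the tree's `pairingSum` and the right-hand side is the tree's `wickRemainder`
(`AizenmanWickBound`: the `4`-subsets `restrictFour`, the remaining points `removeFour₂`, in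
increasing order of index) — the same shape as the tree's unit-coupling fact
`aizenman_wickDeviation_le_finite`, here for a general pair interaction on `Λ ⊂ ℤ^d`. The passage to the infinite-volume state is PROVED below
(`LongRangeIsing.wickDeviation_le_state`). NOT vendored: the form with `S_{2n-4}` of the remaining
points (Aizenman–Duminil-Copin 2021, §6.3), which is false at coincident points. Users take
`(h : aizenman_pairInteraction_wickDeviation_le_finite)`.
[cite: Panis2023Triviality, Prop. 4.6 with §4 (finite Λ) and Lemma 4.4] [cite: AizenmanCMP1982, Prop. 12.1, eq. (12.3)] [cite: AizenmanCDM2020, Prop. 7.2, eq. (7.1)] -/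
def aizenman_pairInteraction_wickDeviation_le_finite : Prop :=
  ∀ {d : ℕ} (J : Site d → Site d → ℝ), (∀ x y, 0 ≤ J x y) → ∀ (Λ : Finset (Site d)) (β : ℝ), 0 ≤ β →
    ∀ (n : ℕ), 2 ≤ n → ∀ (x : Fin (2 * n) → Site d), (∀ i, x i ∈ Λ) →
      |corrIn J Λ β x - pairingSum (pairIn J Λ β) n x| ≤
        3 / 2 * wickRemainder (pairIn J Λ β) (ursellFourIn J Λ β) n x

namespace LongRangeIsing

variable {d : ℕ}

/-- **The deviation from Wick's law for the infinite-volume state** `⟨·⟩_{J,0,β}` (`J ≥ 0`, `β ≥ 0`),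
granted the finite-volume inequality: every term converges along the boxes `Λ_L` (which eventually
contain the points) and the inequality is closed. This is Panis's Prop. 4.6 / Aizenman's Prop. 7.2
as printed (infinite volume). [cite: Panis2023Triviality, Prop. 4.6] [cite: AizenmanCDM2020, Prop. 7.2] -/
theorem wickDeviation_le_state (h46 : aizenman_pairInteraction_wickDeviation_le_finite) (J : Site d → Site d → ℝ)
    (hJ : ∀ x y, 0 ≤ J x y) {β : ℝ} (hβ : 0 ≤ β) {n : ℕ} (hn : 2 ≤ n) (x : Fin (2 * n) → Site d) :
    |corr J β x - pairingSum (pairCorrelation J β) n x| ≤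
      3 / 2 * wickRemainder (pairCorrelation J β) (fun u => ursellFour J β (u 0) (u 1) (u 2) (u 3)) n x := by
  have hT := fun a b => tendsto_pairIn_box J β hβ hJ a b
  refine le_of_tendsto_of_tendsto
    (((tendsto_corrIn_box J β hβ hJ x).sub (tendsto_pairingSum hT n x)).abs)
    (Tendsto.const_mul _ (tendsto_wickRemainder hT (fun u => tendsto_ursellFourIn_box J β hβ hJ u) n x)) ?_
  filter_upwards [eventually_forall_mem_box x] with L hL
  exact h46 J hJ (box d L) β hβ n hn x hL

end LongRangeIsing

namespace LongRangeIsing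

variable {d : ℕ}

/-! ### The infinite-volume state through a finite window, as a probability measure on `{±1}^{ℤ^d}` -/

section WindowState

variable (J : Site d → Site d → ℝ) (β : ℝ) (B : Finset (Site d))

/-- **The window state**: the law of `glue B τ free` under the window law `windowMeasure J β B`
(the marginal of `⟨·⟩_{J,0,β}` on the spins of `B`, spins off `B` frozen by the free boundary
condition's outside value) — a probability measure on `SpinConfig (Site d)` whose integrals of
`B`-local observables are their infinite-volume expectations. [folklore] -/
def windowState (hβ : 0 ≤ β) (hJ : ∀ x y, 0 ≤ J x y) : Measure (SpinConfig (Site d)) :=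
  (windowMeasure J β B hβ hJ).map fun τ => glue B τ .free

/-- The window state is a probability measure (an instance for the tree's own `windowState`; it
overrides nothing). [folklore] -/
instance windowState.isProbabilityMeasure (hβ : 0 ≤ β) (hJ : ∀ x y, 0 ≤ J x y) :
    IsProbabilityMeasure (windowState J β B hβ hJ) := by
  unfold windowState
  exact Measure.isProbabilityMeasure_map (measurable_glue B .free).aemeasurable

/-- Integrals against the window state are the weighted sums over window configurations. [folklore] -/
theorem integral_windowState (hβ : 0 ≤ β) (hJ : ∀ x y, 0 ≤ J x y) {F : SpinConfig (Site d) → ℝ}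
    (hF : Measurable F) :
    ∫ σ, F σ ∂(windowState J β B hβ hJ) = ∑ τ : SpinConfig ↥B, F (glue B τ .free) * windowWeight J β B τ := by
  rw [windowState, integral_map (measurable_glue B .free).aemeasurable hF.aestronglyMeasurable,
    integral_windowMeasure]

/-- **`⟨F⟩_{J,0,β} = ∫ F d(windowState)` for every measurable `B`-local observable `F`.** [folklore] -/
theorem state_eq_integral_windowState (hβ : 0 ≤ β) (hJ : ∀ x y, 0 ≤ J x y) {F : SpinConfig (Site d) → ℝ}
    (hF : Measurable F) (hloc : ∀ σ, F σ = F (glue B (restrictTo B σ) .free)) :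
    state J β 0 F = ∫ σ, F σ ∂(windowState J β B hβ hJ) := by
  have h := state_comp_restrictTo J β B hβ hJ (fun τ => F (glue B τ .free))
  have hobs : (fun σ => F (glue B (restrictTo B σ) .free)) = F := (funext hloc).symm
  rw [hobs] at h
  rw [integral_windowState J β B hβ hJ hF]
  exact h

/-- Spins inside the window are not changed by restricting and gluing back. [folklore] -/
theorem spinAt_glue_restrictTo {x : Site d} (hx : x ∈ B) (σ : SpinConfig (Site d)) :
    spinAt x (glue B (restrictTo B σ) .free) = spinAt x σ := by
  rw [spinAt_glue_of_mem _ _ hx]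
  rfl

/-- The correlation functions of the window state at points of `B` are those of `⟨·⟩_{J,0,β}`. [folklore] -/
theorem nPoint_windowState (hβ : 0 ≤ β) (hJ : ∀ x y, 0 ≤ J x y) {m : ℕ} {x : Fin m → Site d}
    (hx : ∀ i, x i ∈ B) : nPoint (windowState J β B hβ hJ) spinAt x = corr J β x := by
  rw [nPoint, corr, state_eq_integral_windowState J β B hβ hJ
    (Finset.measurable_prod _ fun i _ => measurable_spinAt (x i))]
  intro σ
  exact Finset.prod_congr rfl fun i _ => (spinAt_glue_restrictTo B (hx i) σ).symm

/-- The two-point function of the window state at points of `B`. [folklore] -/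
theorem twoPoint_windowState (hβ : 0 ≤ β) (hJ : ∀ x y, 0 ≤ J x y) {a b : Site d} (ha : a ∈ B) (hb : b ∈ B) :
    twoPoint (windowState J β B hβ hJ) spinAt a b = pairCorrelation J β a b := by
  rw [twoPoint, pairCorrelation, state_eq_integral_windowState J β B hβ hJ
    (F := fun σ => spinAt a σ * spinAt b σ) ((measurable_spinAt a).mul (measurable_spinAt b))]
  intro σ
  rw [spinAt_glue_restrictTo B ha, spinAt_glue_restrictTo B hb]

/-- The four-point Ursell function of the window state at points of `B`. [folklore] -/
theorem connectedFour_windowState (hβ : 0 ≤ β) (hJ : ∀ x y, 0 ≤ J x y) {u : Fin 4 → Site d}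
    (hu : ∀ j, u j ∈ B) :
    connectedFour (windowState J β B hβ hJ) spinAt u = ursellFour J β (u 0) (u 1) (u 2) (u 3) := by
  rw [connectedFour, ursellFour, ← corr_eq_fourCorrelation, nPoint_windowState J β B hβ hJ hu,
    twoPoint_windowState J β B hβ hJ (hu 0) (hu 1), twoPoint_windowState J β B hβ hJ (hu 2) (hu 3),
    twoPoint_windowState J β B hβ hJ (hu 0) (hu 2), twoPoint_windowState J β B hβ hJ (hu 1) (hu 3),
    twoPoint_windowState J β B hβ hJ (hu 0) (hu 3), twoPoint_windowState J β B hβ hJ (hu 1) (hu 2)]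

/-- `Λ_L` in the real parametrisation of `HighDimTriviality` is the box `box d L`. [folklore] -/
theorem latticeBox_natCast (L : ℕ) : latticeBox d (L : ℝ) = box d L := by
  rw [latticeBox_eq_box (Nat.cast_nonneg L), Nat.floor_natCast]

/-- `Λ_{RL}` for naturals `R, L`. [folklore] -/
theorem latticeBox_natCast_mul (R L : ℕ) : latticeBox d ((R : ℝ) * (L : ℝ)) = box d (R * L) := by
  rw [← Nat.cast_mul, latticeBox_natCast]

/-- `Σ_L` of the window state is `Σ_L(β)` when `Λ_L ⊆ B`. [folklore] -/
theorem blockSpinVariance_windowState (hβ : 0 ≤ β) (hJ : ∀ x y, 0 ≤ J x y) {L : ℕ} (hLB : box d L ⊆ B) :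
    blockSpinVariance (windowState J β B hβ hJ) (L : ℝ) = blockVariance J β L := by
  rw [blockSpinVariance, blockVariance, latticeBox_natCast, state_eq_integral_windowState J β B hβ hJ
    ((Finset.measurable_sum _ fun x _ => measurable_spinAt x).pow_const 2)]
  intro σ
  congr 1
  exact Finset.sum_congr rfl fun x hx => (spinAt_glue_restrictTo B (hLB hx) σ).symm

/-- The normalised field of the window state is the barrier's smeared observable `T_{f,L,β}` when
`Λ_L ⊆ B`. [folklore] -/
theorem normalizedField_windowState (hβ : 0 ≤ β) (hJ : ∀ x y, 0 ≤ J x y) {L : ℕ} (hLB : box d L ⊆ B)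
    (f : EuclideanSpace ℝ (Fin d) → ℝ) :
    normalizedField (windowState J β B hβ hJ) (L : ℝ) f = smeared J β L f := by
  funext σ
  rw [normalizedField, smeared, blockSpinVariance_windowState J β B hβ hJ hLB, div_eq_inv_mul]

/-- The smeared observable as a finite lattice sum over any set containing the lattice support. [folklore] -/
theorem smeared_eq_sum_div_sqrt (L : ℕ) (f : EuclideanSpace ℝ (Fin d) → ℝ) {B' : Finset (Site d)}
    (hsupp : ∀ x : Site d, f ((L : ℝ)⁻¹ • siteVec x) ≠ 0 → x ∈ B') (σ : SpinConfig (Site d)) :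
    smeared J β L f σ = (∑ x ∈ B', f ((L : ℝ)⁻¹ • siteVec x) * spinAt x σ) / Real.sqrt (blockVariance J β L) := by
  rw [smeared]
  congr 1
  apply finsum_eq_sum_of_support_subset
  intro x hx
  rw [Function.mem_support] at hx
  exact Finset.mem_coe.2 (hsupp x fun h0 => hx (by rw [h0, zero_mul]))

/-- The smeared observable is measurable. [folklore] -/
theorem measurable_smeared (L : ℕ) (f : EuclideanSpace ℝ (Fin d) → ℝ) {B' : Finset (Site d)}
    (hsupp : ∀ x : Site d, f ((L : ℝ)⁻¹ • siteVec x) ≠ 0 → x ∈ B') : Measurable (smeared J β L f) := by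
  have h : smeared J β L f = fun σ =>
      (∑ x ∈ B', f ((L : ℝ)⁻¹ • siteVec x) * spinAt x σ) / Real.sqrt (blockVariance J β L) :=
    funext fun σ => smeared_eq_sum_div_sqrt J β L f hsupp σ
  rw [h]
  exact (Finset.measurable_sum _ fun x _ => (measurable_spinAt x).const_mul _).div_const _

/-- **Moments of `T_{f,L,β}` are moments of the normalised field of the window state** (`Λ_L ⊆ B`,
lattice support of `f(·/L)` inside `B`). [folklore] -/
theorem integral_normalizedField_windowState (hβ : 0 ≤ β) (hJ : ∀ x y, 0 ≤ J x y) {L : ℕ}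
    (hLB : box d L ⊆ B) (f : EuclideanSpace ℝ (Fin d) → ℝ)
    (hsupp : ∀ x : Site d, f ((L : ℝ)⁻¹ • siteVec x) ≠ 0 → x ∈ B) (ψ : ℝ → ℝ) (hψ : Measurable ψ) :
    ∫ σ, ψ (normalizedField (windowState J β B hβ hJ) (L : ℝ) f σ) ∂(windowState J β B hβ hJ) =
      state J β 0 (fun σ => ψ (smeared J β L f σ)) := by
  rw [normalizedField_windowState J β B hβ hJ hLB f, state_eq_integral_windowState J β B hβ hJ
    (F := fun σ => ψ (smeared J β L f σ)) (hψ.comp (measurable_smeared J β L f hsupp))]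
  intro σ
  exact congrArg ψ (smeared_eq_smeared_glue_restrictTo J β L f hsupp σ)

/-- **`S` of the window state is `S(β,L,R)`** when `Λ_{RL} ⊆ B` and `Λ_L ⊆ B`. [folklore] -/
theorem ursellFourSum_windowState (hβ : 0 ≤ β) (hJ : ∀ x y, 0 ≤ J x y) {L R : ℕ} (hLB : box d L ⊆ B)
    (hRL : box d (R * L) ⊆ B) :
    ursellFourSum (windowState J β B hβ hJ) (L : ℝ) (R : ℝ) = ursellFourBoxSum J β L R := by
  rw [ursellFourSum, ursellFourBoxSum, latticeBox_natCast_mul, blockSpinVariance_windowState J β B hβ hJ hLB]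
  congr 1
  refine Finset.sum_congr rfl fun u hu => ?_
  rw [connectedFour_windowState J β B hβ hJ fun j => hRL (Fintype.mem_piFinset.mp hu j)]

/-- **The window state satisfies the pairing-form inequality at all points of `Λ_{RL} ⊆ B`**, granted
the finite-volume fact (through `wickDeviation_le_state` and the identifications above). [cite: Panis2023Triviality, Prop. 4.6] -/
theorem wickDeviationBoundOn_windowState (h46 : aizenman_pairInteraction_wickDeviation_le_finite) (hβ : 0 ≤ β)
    (hJ : ∀ x y, 0 ≤ J x y) {L R : ℕ} (hRL : box d (R * L) ⊆ B) (n : ℕ) (hn : 2 ≤ n)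
    (x : Fin (2 * n) → Site d) (hx : ∀ i, x i ∈ latticeBox d ((R : ℝ) * (L : ℝ))) :
    |nPoint (windowState J β B hβ hJ) spinAt x - pairingSum (twoPoint (windowState J β B hβ hJ) spinAt) n x| ≤
      3 / 2 * wickRemainder (twoPoint (windowState J β B hβ hJ) spinAt)
        (connectedFour (windowState J β B hβ hJ) spinAt) n x := by
  rw [latticeBox_natCast_mul] at hx
  have hxB : ∀ i, x i ∈ B := fun i => hRL (hx i)
  rw [nPoint_windowState J β B hβ hJ hxB,
    pairingSum_congr_apply (fun i j => twoPoint_windowState J β B hβ hJ (hxB i) (hxB j)),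
    wickRemainder_congr_of_eq (twoPoint (windowState J β B hβ hJ) spinAt) (pairCorrelation J β)
      (connectedFour (windowState J β B hβ hJ) spinAt) (fun u => ursellFour J β (u 0) (u 1) (u 2) (u 3))
      n x x (fun i j => twoPoint_windowState J β B hβ hJ (hxB i) (hxB j))
      (fun e => connectedFour_windowState J β B hβ hJ fun j => hxB (e j))]
  exact wickDeviation_le_state h46 J hJ hβ hn x

end WindowState

end LongRangeIsing

open LongRangeIsing

/-! ### The moment display in the form Proposition 4.6 yields (corrected statement), PROVED -/

/-- NAMED FACT — **corrected statement of `panis_evenMoment_deviation_le` (Panis 2023, proof of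
Theorem 5.5, first display, p. 21).** The Moments file vendored the display as printed,
`|⟨T_{f,L,β}^{2n}⟩_β - (2n)!/(2ⁿn!)⟨T_{f,L,β}²⟩_βⁿ| ≤ (3/2)(2n)⁴ ⟨T_{|f|,L,β}^{2n-4}⟩_β ‖f‖_∞⁴ S(β,L,f)`,
for all `n ≥ 2`, `L ≥ 1` and all test functions; that statement is FALSE (single-site smearing:
`not_panis_evenMoment_deviation_le_of_criticalBeta_pos` below) and does not follow from the source's
Proposition 4.6, whose right-hand side carries the pairing sum of the remaining `2n-4` points: smeared
against `∏|f(x_m/L)|` that pairing sum is the Gaussian moment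
`(2n-4)!/(2^{n-2}(n-2)!) ⟨T_{|f|,L,β}²⟩_β^{n-2}` (Aizenman CDM 2020, (7.6)–(7.10), "through elementary
combinatorics"), not `⟨T_{|f|,L,β}^{2n-4}⟩_β`. This is the display with that factor corrected — what
"Using Proposition 4.6 one gets for `n ≥ 2`" actually gives — under the same hypotheses as the
misstated fact (Theorem 5.5 / Theorem 1.2: `J_{x,y} = C₀|x-y|₁^{-d-α}`, `C₀, α > 0`, `d - 2(α∧2) > 0`,
`0 < β ≤ β_c`, natural `L ≥ 1`, `Λ_{RL}` with `f = 0` off `[-R,R]^d`, `R ≥ 1`). It is all the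
summation over `n` uses (`panis_mgfDeviation_le_ursellFourBoxSum_of_wick`), and it is PROVED from
`aizenman_pairInteraction_wickDeviation_le_finite` (`panis_evenMoment_deviation_le_wick_of_finite`). Users take
`(h : panis_evenMoment_deviation_le_wick)`.
[cite: Panis2023Triviality, proof of Theorem 5.5, first display (p. 21), from Proposition 4.6] [cite: AizenmanCDM2020, eqs. (7.6)–(7.10)] -/
def panis_evenMoment_deviation_le_wick : Prop :=
  ∀ (d : ℕ), 1 ≤ d → ∀ (C₀ α : ℝ), 0 < C₀ → 0 < α → 0 < (d : ℝ) - 2 * min α 2 →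
    ∀ (β : ℝ), 0 < β → β ≤ LongRangeIsing.criticalBeta (algebraicCoupling d C₀ α) →
      ∀ (L R : ℕ), 1 ≤ L → 1 ≤ R →
        ∀ (f : EuclideanSpace ℝ (Fin d) → ℝ), Continuous f → (∀ x, f x ≠ 0 → ∀ i, |x i| ≤ R) →
          ∀ (n : ℕ), 2 ≤ n →
            |state (algebraicCoupling d C₀ α) β 0 (fun σ => smeared (algebraicCoupling d C₀ α) β L f σ ^ (2 * n)) -
                ((2 * n)! : ℝ) / (2 ^ n * n !) *
                  state (algebraicCoupling d C₀ α) β 0 (fun σ => smeared (algebraicCoupling d C₀ α) β L f σ ^ 2) ^ n| ≤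
              3 / 2 * (2 * n : ℝ) ^ 4 *
                (((2 * (n - 2))! : ℝ) / (2 ^ (n - 2) * (n - 2)!) *
                  state (algebraicCoupling d C₀ α) β 0
                    (fun σ => smeared (algebraicCoupling d C₀ α) β L (fun x => |f x|) σ ^ 2) ^ (n - 2)) *
                (⨆ x, |f x|) ^ 4 * ursellFourBoxSum (algebraicCoupling d C₀ α) β L R

/-- **The corrected moment display holds, granted the deviation from Wick's law in finite volume**
(in fact for every `β > 0`, `L ≥ 1`, `R ≥ 1`; the extra hypotheses of the display are not used):
realise `⟨·⟩_{J,0,β}` on the window `Λ_{RL}` as the probability measure `windowState`, apply the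
tree's smearing theorem `abs_integral_normalizedField_pow_sub_le_of_wickDeviationBoundOn` to it,
and read the moments, `Σ_L`, `‖f‖_∞` and `S` back in the barrier's notation.
[cite: Panis2023Triviality, proof of Theorem 5.5, first display (p. 21)] [cite: AizenmanCDM2020, Prop. 7.2 and (7.6)–(7.10)] -/
theorem panis_evenMoment_deviation_le_wick_of_finite (h46 : aizenman_pairInteraction_wickDeviation_le_finite) :
    panis_evenMoment_deviation_le_wick := by
  intro d _hd C₀ α hC₀ _hα _hexp β hβ _hβc L R hL hR f hf hfR n hn
  set J := algebraicCoupling d C₀ α with hJdef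
  have hJ : ∀ x y, 0 ≤ J x y := algebraicCoupling_nonneg hC₀.le α
  have hβ0 : 0 ≤ β := hβ.le
  set B : Finset (Site d) := box d (R * L) with hB
  have hRL : box d (R * L) ⊆ B := Finset.Subset.refl _
  have hLB : box d L ⊆ B := box_mono d (Nat.le_mul_of_pos_left L hR)
  have hsupp : ∀ x : Site d, f ((L : ℝ)⁻¹ • siteVec x) ≠ 0 → x ∈ B :=
    fun x hx => mem_box_mul_of_apply_ne_zero hfR hL x hx
  have hfaR : ∀ x, (fun x => |f x|) x ≠ 0 → ∀ i, |x i| ≤ R := fun x hx => hfR x (fun h0 => hx (by simp [h0]))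
  have hsuppa : ∀ x : Site d, (fun x => |f x|) ((L : ℝ)⁻¹ • siteVec x) ≠ 0 → x ∈ B :=
    fun x hx => mem_box_mul_of_apply_ne_zero hfaR hL x hx
  have hLpos : (0 : ℝ) < L := by exact_mod_cast hL
  have hfR' : ∀ x, f x ≠ 0 → ∀ i, |x i| ≤ (R : ℝ) := hfR
  have key := abs_integral_normalizedField_pow_sub_le_of_wickDeviationBoundOn
    (μ := windowState J β B hβ0 hJ) (r := (R : ℝ)) hLpos
    (fun m hm y hy => wickDeviationBoundOn_windowState J β B h46 hβ0 hJ hRL m hm y hy) hf hfR' hn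
  rw [integral_normalizedField_windowState J β B hβ0 hJ hLB f hsupp (fun t => t ^ (2 * n))
      (measurable_id.pow_const _),
    integral_normalizedField_windowState J β B hβ0 hJ hLB f hsupp (fun t => t ^ 2) (measurable_id.pow_const _),
    integral_normalizedField_windowState J β B hβ0 hJ hLB (fun x => |f x|) hsuppa (fun t => t ^ 2)
      (measurable_id.pow_const _),
    ursellFourSum_windowState J β B hβ0 hJ hLB hRL] at key
  calc _ ≤ _ := key
    _ = _ := by ring

/-! ### The moment-generating-function bound, Theorem 1.2 and the barrier from the corrected display -/

/-- **`panis_mgfDeviation_le_ursellFourBoxSum` from the corrected moment display** (the summation of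
the proof of Theorem 5.5, "Multiplying by `z^{2n}/(2n)!` and summing over `n`", by
`abs_mgf_sub_exp_le_of_wickMoment_bounds` on the window law with the flip symmetry `⟨T^{2m+1}⟩ = 0`;
constant `C₁ = 16 · 3/2 = 24`; Newman's Gaussian domination is not needed since the majorant is
already Gaussian). [cite: Panis2023Triviality, proof of Theorem 5.5, first two displays (p. 21)] -/
theorem panis_mgfDeviation_le_ursellFourBoxSum_of_wick (h51 : panis_evenMoment_deviation_le_wick) :
    panis_mgfDeviation_le_ursellFourBoxSum := by
  intro d hd C₀ α hC₀ hα hexp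
  refine ⟨24, by norm_num, ?_⟩
  intro β hβ hβc L R hL hR f hf hfR z
  set J := algebraicCoupling d C₀ α with hJdef
  have hJ : ∀ x y, 0 ≤ J x y := algebraicCoupling_nonneg hC₀.le α
  have hβ0 : 0 ≤ β := hβ.le
  set B : Finset (Site d) := box d (R * L) with hB
  have hsupp : ∀ x : Site d, f ((L : ℝ)⁻¹ • siteVec x) ≠ 0 → x ∈ B :=
    fun x hx => mem_box_mul_of_apply_ne_zero hfR hL x hx
  have hfaR : ∀ x, (fun x => |f x|) x ≠ 0 → ∀ i, |x i| ≤ R := fun x hx => hfR x (fun h0 => hx (by simp [h0]))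
  have hsuppa : ∀ x : Site d, (fun x => |f x|) ((L : ℝ)⁻¹ • siteVec x) ≠ 0 → x ∈ B :=
    fun x hx => mem_box_mul_of_apply_ne_zero hfaR hL x hx
  -- the window law and the two random variables
  set μ := windowMeasure J β B hβ0 hJ with hμ
  set X : SpinConfig ↥B → ℝ := fun τ => smeared J β L f (glue B τ .free) with hX
  set Y : SpinConfig ↥B → ℝ := fun τ => smeared J β L (fun x => |f x|) (glue B τ .free) with hY
  have hSX : ∀ ψ : ℝ → ℝ, state J β 0 (fun σ => ψ (smeared J β L f σ)) = ∫ τ, ψ (X τ) ∂μ :=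
    fun ψ => state_fun_smeared_eq_integral J β hβ0 hJ L f hsupp ψ
  have hSY : ∀ ψ : ℝ → ℝ, state J β 0 (fun σ => ψ (smeared J β L (fun x => |f x|) σ)) = ∫ τ, ψ (Y τ) ∂μ :=
    fun ψ => state_fun_smeared_eq_integral J β hβ0 hJ L (fun x => |f x|) hsuppa ψ
  -- hypotheses of the summation theorem
  have hXm : Measurable X := measurable_of_finite X
  have hXb : ∀ τ, |X τ| ≤ ∑ τ' : SpinConfig ↥B, |X τ'| := fun τ =>
    Finset.single_le_sum (f := fun τ' => |X τ'|) (fun τ' _ => abs_nonneg _) (Finset.mem_univ τ)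
  set F4 : ℝ := (⨆ x, |f x|) ^ 4 with hF4
  have hF40 : 0 ≤ F4 := pow_nonneg (Real.iSup_nonneg fun x => abs_nonneg (f x)) 4
  set S : ℝ := ursellFourBoxSum J β L R with hS
  have hS0 : 0 ≤ S := ursellFourBoxSum_nonneg J β L R
  set E : ℝ := 3 / 2 * F4 * S with hE
  have hE0 : 0 ≤ E := by positivity
  set W : ℝ := ∫ τ, Y τ ^ 2 ∂μ with hW
  have hW0 : 0 ≤ W := integral_nonneg fun τ => sq_nonneg _
  have hdev : ∀ n : ℕ, 2 ≤ n →
      |(∫ τ, X τ ^ (2 * n) ∂μ) - ((2 * n)! : ℝ) / (2 ^ n * n !) * (∫ τ, X τ ^ 2 ∂μ) ^ n|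
        ≤ (2 * n : ℝ) ^ 4 * E * ((((2 * (n - 2))! : ℝ) / (2 ^ (n - 2) * (n - 2)!)) * W ^ (n - 2)) := by
    intro n hn
    have h := h51 d hd C₀ α hC₀ hα hexp β hβ hβc L R hL hR f hf hfR n hn
    rw [hSX (fun t => t ^ (2 * n)), hSX (fun t => t ^ 2), hSY (fun t => t ^ 2)] at h
    calc |(∫ τ, X τ ^ (2 * n) ∂μ) - ((2 * n)! : ℝ) / (2 ^ n * n !) * (∫ τ, X τ ^ 2 ∂μ) ^ n|
        ≤ 3 / 2 * (2 * n : ℝ) ^ 4 * ((((2 * (n - 2))! : ℝ) / (2 ^ (n - 2) * (n - 2)!)) * W ^ (n - 2)) *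
            F4 * S := h
      _ = (2 * n : ℝ) ^ 4 * E * ((((2 * (n - 2))! : ℝ) / (2 ^ (n - 2) * (n - 2)!)) * W ^ (n - 2)) := by
          rw [hE]; ring
  have hodd : ∀ n : ℕ, ∫ τ, X τ ^ (2 * n + 1) ∂μ = 0 := by
    intro n
    rw [← hSX (fun t => t ^ (2 * n + 1))]
    exact state_smeared_odd_pow J β L f hsupp n
  have key := abs_mgf_sub_exp_le_of_wickMoment_bounds (μ := μ) hXm hXb hE0 hW0 hdev hodd z
  -- back to the state
  have e1 : state J β 0 (fun σ => Real.exp (z * smeared J β L f σ)) = ∫ τ, Real.exp (z * X τ) ∂μ :=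
    hSX fun t => Real.exp (z * t)
  have e2 : state J β 0 (fun σ => smeared J β L f σ ^ 2) = ∫ τ, X τ ^ 2 ∂μ := hSX fun t => t ^ 2
  have e3 : state J β 0 (fun σ => smeared J β L (fun x => |f x|) σ ^ 2) = W := hSY fun t => t ^ 2
  rw [mgfDeviation, e1, e2, e3]
  calc |(∫ τ, Real.exp (z * X τ) ∂μ) - Real.exp (z ^ 2 / 2 * ∫ τ, X τ ^ 2 ∂μ)|
      ≤ 16 * E * z ^ 4 * Real.exp (z ^ 2 / 2 * W) := key
    _ = 24 * z ^ 4 * Real.exp (z ^ 2 / 2 * W) * F4 * S := by rw [hE]; ring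

/-- **Panis's Theorem 1.2 from the deviation from Wick's law in finite volume (pairing form) and the
bound on `S(β,L,f)`.** [cite: Panis2023Triviality, Theorem 1.2 and proof of Theorem 5.5 (pp. 21–22)] -/
theorem panis_thm12_of_wick (h46 : aizenman_pairInteraction_wickDeviation_le_finite) (hS : panis_ursellFourBoxSum_le) :
    panis_thm12 :=
  panis_thm12_of_inputs
    (panis_mgfDeviation_le_ursellFourBoxSum_of_wick (panis_evenMoment_deviation_le_wick_of_finite h46)) hS

/-- **The barrier `LongRangeTrivialityOnZ3` from Aizenman's Theorem 12.1 / Panis's Proposition 4.6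
(finite volume, pairing form) and the bound on `S(β,L,f)`** — the trust base of the barrier after this
file: `aizenman_pairInteraction_wickDeviation_le_finite` (random currents, switching lemma) and
`panis_ursellFourBoxSum_le` (tree diagram bound, infrared bounds, MMS). [cite: Panis2023Triviality, Theorem 1.2 and Prop. 4.6] -/
theorem LongRangeTrivialityOnZ3.of_wick (h46 : aizenman_pairInteraction_wickDeviation_le_finite)
    (hS : panis_ursellFourBoxSum_le) : LongRangeTrivialityOnZ3 :=
  LongRangeTrivialityOnZ3.of_thm12 (panis_thm12_of_wick h46 hS)

/-! ### The misstated display is false -/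

namespace LongRangeIsing

variable {d : ℕ}

/-- `|U₄^β(a,b,c,e)| ≤ 4` (`β ≥ 0`, `J ≥ 0`: every correlation of `±1` spins is at most `1` in
absolute value). [folklore] -/
theorem abs_ursellFour_le_four (J : Site d → Site d → ℝ) (hJ : ∀ x y, 0 ≤ J x y) {β : ℝ} (hβ : 0 ≤ β)
    (a b c e : Site d) : |ursellFour J β a b c e| ≤ 4 := by
  have h4 : |fourCorrelation J β a b c e| ≤ 1 := by
    have h := abs_corr_le_one J β hβ hJ ![a, b, c, e]
    rw [corr_eq_fourCorrelation] at h
    simpa using h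
  have hp := fun x y => abs_pairCorrelation_le_one J β hβ hJ x y
  have hpp : ∀ x y z t, |pairCorrelation J β x y * pairCorrelation J β z t| ≤ 1 := fun x y z t => by
    rw [abs_mul]
    exact mul_le_one₀ (hp x y) (abs_nonneg _) (hp z t)
  rw [ursellFour]
  have step : ∀ A B C D : ℝ, |A - B - C - D| ≤ |A| + |B| + |C| + |D| := fun A B C D =>
    calc |A - B - C - D| ≤ |A - B - C| + |D| := abs_sub _ _
      _ ≤ |A - B| + |C| + |D| := by gcongr; exact abs_sub _ _
      _ ≤ |A| + |B| + |C| + |D| := by gcongr; exact abs_sub _ _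
  linarith [step (fourCorrelation J β a b c e) (pairCorrelation J β a b * pairCorrelation J β c e)
    (pairCorrelation J β a c * pairCorrelation J β b e) (pairCorrelation J β a e * pairCorrelation J β b c),
    hpp a b c e, hpp a c b e, hpp a e b c]

end LongRangeIsing

-- names the `@[deprecated]` record `panis_evenMoment_deviation_le` of `…Moments` on purpose: this IS its refutation
-- (verdict clean-up 2026-08-16); REMOVE-WHEN the record is deleted from `…Moments`
set_option linter.deprecated false in
/-- **The vendored display `panis_evenMoment_deviation_le` is inconsistent with `β_c > 0`** (hence
false, `panis_criticalBeta_pos` being Fisher's `β_c ≥ |J|⁻¹`). Counterexample: `d = 2`, `C₀ = 1`,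
`α = 1/2` (so `d - 2(α∧2) = 1 > 0`), `β = β_c`, `L = R = 1`, and the continuous bump
`f(v) = max(0, 1 - 2(|v₀| + |v₁|))`, supported in `[-1,1]²` and vanishing at every lattice point but
`0`, where `f = 1 = ‖f‖_∞`. Then `T_{f,1,β} = T_{|f|,1,β} = σ₀/√Σ₁`, so `⟨T^{2k}⟩ = Σ₁^{-k}`
(`σ₀² = 1`), and at `n = 12` the display reads
`((24)!/(2¹²12!) - 1) Σ₁⁻¹² ≤ (3/2)·24⁴·Σ₁⁻¹⁰·‖f‖_∞⁴·S(β,1,1)` with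
`S(β,1,1) = ∑_{Λ₁⁴}|U₄|/Σ₁² ≤ 4·9⁴/Σ₁²`, i.e. `316234143224 ≤ 13060694016` — false (`Σ₁ ≥ 1`).
The mechanism (a `(2n-1)!!` on the left against a polynomial in `n` on the right) is that of the
coincident-point failure of the `S_{2n-4}` form of Aizenman's inequality; the printed pairing form
and the corrected display `panis_evenMoment_deviation_le_wick` are unaffected. [folklore] -/
theorem not_panis_evenMoment_deviation_le_of_criticalBeta_pos (hβc : panis_criticalBeta_pos) :
    ¬ panis_evenMoment_deviation_le := by
  intro h
  -- the test function
  set g : EuclideanSpace ℝ (Fin 2) → ℝ := fun v => ∑ i, |v i| with hg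
  set f : EuclideanSpace ℝ (Fin 2) → ℝ := fun v => max 0 (1 - 2 * g v) with hf
  have hgc : Continuous g := by
    rw [hg]
    exact continuous_finsetSum _ fun i _ => (PiLp.continuous_apply 2 _ i).abs
  have hfc : Continuous f := by
    rw [hf]
    exact continuous_const.max (continuous_const.sub (continuous_const.mul hgc))
  have hg0' : ∀ v, 0 ≤ g v := fun v => Finset.sum_nonneg fun i _ => abs_nonneg _
  have hf0 : ∀ v, 0 ≤ f v := fun v => le_max_left _ _
  have hf1 : ∀ v, f v ≤ 1 := fun v => max_le zero_le_one (by linarith [hg0' v])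
  have hfR : ∀ v, f v ≠ 0 → ∀ i, |v i| ≤ ((1 : ℕ) : ℝ) := by
    intro v hv i
    have hlt : g v < 1 / 2 := by
      by_contra hge
      push Not at hge
      apply hv
      show max 0 (1 - 2 * g v) = 0
      exact max_eq_left (by linarith)
    have hi : |v i| ≤ g v :=
      Finset.single_le_sum (f := fun j => |v j|) (fun j _ => abs_nonneg _) (Finset.mem_univ i)
    push_cast
    linarith
  -- the model `d = 2`, `C₀ = 1`, `α = 1/2` at `β = β_c > 0`, and the display at `L = R = 1`, `n = 12`
  have hexp : 0 < ((2 : ℕ) : ℝ) - 2 * min (1 / 2 : ℝ) 2 := by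
    rw [min_eq_left (by norm_num)]
    norm_num
  have hβ : 0 < LongRangeIsing.criticalBeta (algebraicCoupling 2 1 (1 / 2)) :=
    hβc 2 le_rfl 1 (1 / 2) one_pos (by norm_num)
  have hmain := h 2 (by norm_num) 1 (1 / 2) one_pos (by norm_num) hexp _ hβ le_rfl 1 1 le_rfl le_rfl
    f hfc hfR 12 (by norm_num)
  set J : Site 2 → Site 2 → ℝ := algebraicCoupling 2 1 (1 / 2) with hJdef
  set β : ℝ := LongRangeIsing.criticalBeta J with hβdef
  have hJ : ∀ x y, 0 ≤ J x y := algebraicCoupling_nonneg zero_le_one (1 / 2)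
  have hβ0 : 0 ≤ β := hβ.le
  -- `f(x/1) = 𝟙{x = 0}` on the lattice
  have hsmul : ∀ x : Site 2, ((1 : ℕ) : ℝ)⁻¹ • siteVec x = siteVec x := fun x => by simp
  have hg0 : g (siteVec (0 : Site 2)) = 0 := by simp [hg]
  have hf0v : f (siteVec (0 : Site 2)) = 1 := by
    simp only [hf, hg0, mul_zero, sub_zero]
    exact max_eq_right zero_le_one
  have hfx : ∀ x : Site 2, x ≠ 0 → f (siteVec x) = 0 := by
    intro x hx
    obtain ⟨i, hi⟩ := Function.ne_iff.mp hx
    have h1 : (1 : ℝ) ≤ |(x i : ℝ)| := by exact_mod_cast Int.one_le_abs hi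
    have h2 : |(x i : ℝ)| ≤ g (siteVec x) := by
      have := Finset.single_le_sum (f := fun j : Fin 2 => |(x j : ℝ)|) (fun j _ => abs_nonneg _)
        (Finset.mem_univ i)
      simpa [hg] using this
    show max 0 (1 - 2 * g (siteVec x)) = 0
    exact max_eq_left (by linarith)
  -- `T_{f,1,β} = σ₀/√Σ₁`
  set V₁ : ℝ := blockVariance J β 1 with hV₁
  have hV1 : 1 ≤ V₁ := one_le_blockVariance J β hβ0 hJ 1
  have hVpos : 0 < V₁ := one_pos.trans_le hV1
  have hT : ∀ σ : SpinConfig (Site 2), smeared J β 1 f σ = spinAt 0 σ / Real.sqrt V₁ := by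
    intro σ
    rw [smeared]
    congr 1
    have hfun : (fun x : Site 2 => f (((1 : ℕ) : ℝ)⁻¹ • siteVec x) * spinAt x σ) =
        fun x => if x = 0 then spinAt 0 σ else 0 := by
      funext x
      by_cases hx : x = 0
      · subst hx
        rw [if_pos rfl, hsmul, hf0v, one_mul]
      · rw [if_neg hx, hsmul, hfx x hx, zero_mul]
    rw [hfun, finsum_eq_single _ 0 (fun x hx => if_neg hx), if_pos rfl]
  have hs2 : ∀ σ : SpinConfig (Site 2), spinAt 0 σ ^ 2 = 1 := fun σ => by rw [sq, spinAt_mul_self]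
  have hsq : Real.sqrt V₁ ^ 2 = V₁ := Real.sq_sqrt hVpos.le
  have hTpow : ∀ k : ℕ, (fun σ : SpinConfig (Site 2) => smeared J β 1 f σ ^ (2 * k)) = fun _ => (V₁ ^ k)⁻¹ := by
    intro k
    funext σ
    rw [hT, div_pow, pow_mul, pow_mul, hs2, hsq, one_pow, one_div]
  have hT2 : (fun σ : SpinConfig (Site 2) => smeared J β 1 f σ ^ 2) = fun _ => V₁⁻¹ := by
    funext σ
    rw [hT, div_pow, hs2, hsq, one_div]
  have habs : (fun v => |f v|) = f := funext fun v => abs_of_nonneg (hf0 v)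
  have hfact : ((2 * 12)! : ℝ) / (2 ^ 12 * ((12)! : ℝ)) = 316234143225 := by
    rw [div_eq_iff (by positivity)]
    norm_num [Nat.factorial]
  rw [habs, show (2 * 12 - 4 : ℕ) = 2 * 10 from rfl, hTpow 12, hTpow 10, hT2, state_const, state_const,
    state_const, hfact] at hmain
  -- `‖f‖_∞ ≤ 1` (after `habs`, `⨆ |f| = ⨆ f`) and `S(β,1,1) ≤ 4 · 9⁴ / Σ₁²`
  have hsup : (⨆ x, f x) ≤ 1 := ciSup_le hf1
  have hsup0 : 0 ≤ ⨆ x, f x := Real.iSup_nonneg hf0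
  have hsup4 : (⨆ x, f x) ^ 4 ≤ 1 := pow_le_one₀ hsup0 hsup
  have hcard : ((Fintype.piFinset fun _ : Fin 4 => box 2 (1 * 1)).card : ℝ) = 6561 := by
    rw [Fintype.card_piFinset, Finset.prod_const, Finset.card_univ, Fintype.card_fin, card_box]
    norm_num
  have hUsum : ∑ u ∈ Fintype.piFinset (fun _ : Fin 4 => box 2 (1 * 1)),
      |ursellFour J β (u 0) (u 1) (u 2) (u 3)| ≤ 26244 := by
    have h1 := Finset.sum_le_card_nsmul (Fintype.piFinset fun _ : Fin 4 => box 2 (1 * 1))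
      (fun u => |ursellFour J β (u 0) (u 1) (u 2) (u 3)|) 4 fun u _ => abs_ursellFour_le_four J hJ hβ0 _ _ _ _
    rw [nsmul_eq_mul, hcard] at h1
    linarith
  have hSnn : 0 ≤ ursellFourBoxSum J β 1 1 := ursellFourBoxSum_nonneg J β 1 1
  have hS : ursellFourBoxSum J β 1 1 ≤ 26244 / V₁ ^ 2 := by
    rw [ursellFourBoxSum]
    exact div_le_div_of_nonneg_right hUsum (by positivity)
  -- the contradiction `316234143224 ≤ 13060694016`
  have hfinal : (316234143224 : ℝ) * (V₁ ^ 12)⁻¹ ≤ 13060694016 * (V₁ ^ 12)⁻¹ :=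
    calc (316234143224 : ℝ) * (V₁ ^ 12)⁻¹ = |(V₁ ^ 12)⁻¹ - 316234143225 * V₁⁻¹ ^ 12| := by
          rw [inv_pow, show (V₁ ^ 12)⁻¹ - 316234143225 * (V₁ ^ 12)⁻¹ = -(316234143224 * (V₁ ^ 12)⁻¹) by ring,
            abs_neg, abs_of_nonneg (by positivity)]
      _ ≤ _ := hmain
      _ ≤ 3 / 2 * (2 * ((12 : ℕ) : ℝ)) ^ 4 * (V₁ ^ 10)⁻¹ * 1 * (26244 / V₁ ^ 2) := by gcongr
      _ = 13060694016 * (V₁ ^ 12)⁻¹ := by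
          push_cast
          field_simp
          ring
  have hpos : (0 : ℝ) < (V₁ ^ 12)⁻¹ := by positivity
  linarith

end Literature.Barriers.CriticalPhenomena

end
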